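import Summits.QuantumFields.BalabanUV.Beta.GAN24.LatticeFreeze

/-!
# `BalabanUV.Beta.GAN24.LayerPushMoments` — binder row G-an2-4 / (CONV-C), W-slot CT-W, route «WC-TL» ∕ «QR-LL», row **(LT-Δ) «LAYER TRANSPORT»**, part (LT-3) — THE FROZEN
# (CHARGED) TERM UNDER THE PER-LABEL MOMENT IDENTITIES (the OWNER gan24-p1 g26's W11 (2), journal l.40372: «the FROZEN term SURVIVES off the fibre diagonal … needs
# EXACTLY the two per-label moment identities (M0_y) `Σ_e Z(σ_j(y;e)) = 0` and (Π_y) `Σ_e (e−y)_λ Z(σ_j(y;e)) = 0` AS DISPLAYED HYPOTHESES, plus a unit SECOND-difference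
# envelope of the slot leg … = the «−1»»): second-order lattice Taylor, the one-label pairing, and the product rule for the frozen leg product

NOT IN PRINT; OUR BOOKKEEPING ([folklore] real analysis on `ℤ^D` over leaf-12's `LatticeFreeze` (`abs_sub_le_of_unit_steps`, `mul_exp_neg_le`, `summable_mul_of_env`); G-an2-4
formalisation swarm, leaf prover `b2b-balaban-gan24-formalise-leaf-01`, gen 63).  HONEST FRAMING (cell contract, verbatim): «discharging `BetaPertH` makes Bałaban's UV
stability UNCONDITIONAL — a real constructive-QFT result; it is NOT the continuum limit and NOT the Clay problem.»  HONEST DEPENDENCY (verbatim): «continuum YM on T⁴ ⇐ BetaPertH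
∧ nine spine estimates (0/9 proved); BetaPertH ⇐ (D1) ∧ (D4) ∧ CAP+tail; G-an2-4 gates asym, D1 and NE2/3/4.»

## What (generic dimension `D`; no legs, no tables — the consumer is (LT-3)'s frozen term `Σ_{κ′} Σ'_u w·l·r·Z` of `LayerPushFrozen.abs_push₃_sub_frozen_le_weighted`)
§1 **`abs_sub_sub_lin_le_of_unit_steps`** — SECOND-ORDER LATTICE TAYLOR: unit gradients Lipschitz from the base point `y`,
   `|(f(p+e_i) − f p) − (f(y+e_i) − f y)| ≤ σ·‖p−y‖₁·e^{κ‖p−y‖₁}` (what unit SECOND differences give through `abs_sub_le_of_unit_steps`), ⇒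
   `|f v − f y − Σ_i (v−y)_i·(f(y+e_i) − f y)| ≤ σ·‖v−y‖₁²·e^{κ‖v−y‖₁}`.
§2 `sq_mul_exp_neg_le` (`t²e^{−ct} ≤ (8∕c²)e^{−(c∕4)t}`); **`abs_tsum_mul_le_of_moments`** — ONE LABEL: a charge profile `Z` localised at `y` (`|Z e| ≤ B·e^{−δ‖e−y‖₁}`) with
   (M0) `Σ'_e Z e = 0` and (Π) `∀ i, Σ'_e (e−y)_i·Z e = 0` DISPLAYED, against a frozen leg product `F` with the §1 hypothesis and `|F| ≤ pF·e^{κ‖·−y‖₁}`, `0 ≤ κ < δ`: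
   `|Σ'_e F e·Z e| ≤ σ·B·(8∕(δ−κ)²)·Zl((δ−κ)∕4)` — the constant and the linear Taylor terms of `F` at `y` integrate to ZERO; only the second-difference allowance survives.
§3 THE PRODUCT RULE for the frozen leg product (two factors; three by iteration): `second_diff_mul_eq` (algebra), **`abs_second_diff_mul_le`**
   (`|∇_j∇_i(ab)| ≤ (ha·pb + 2·ga·gb + pa·hb)·e^{2κ}·e^{2κ‖p−y‖₁}` from sup `p·`, unit-gradient `g·`, unit-second-difference `h·` allowances of the factors — every term ONE
   second difference or TWO first differences: `L^{−(d+4)}·L^{−(d+2)}` or `L^{−(d+3)}·L^{−(d+3)}` in the (LT-3) ledger), `abs_diff_mul_le` (the unit gradient of a product).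
THE TREE INPUT THIS NEEDS DOWNSTREAM AND THE TREE LACKS (located, journal R-leaf01-g63 W11ACK l.40417 (3)): (N1″) — unit SECOND differences of the response legs,
`|∇_i∇_j respStep| ≤ C″·(L^{d+4})⁻¹·env` (`RespStepDecay.exists_respStep_decay_and_grad` stops at the first gradient).
[folklore]; 0 cited facts, 0 `def`, 0 `def … : Prop`, 0 sorry.  Asserts NOTHING about which σ-letters satisfy (M0)∕(Π) (E15: the COMBINED `Ψ_j`, not its pieces, at j = 0 on SDF-1);
NOTHING of (Q-R)∕(LT)∕«T2Shape»∕«T2Drift»∕(hW, hWall) discharged; NEVER «G-an2-4 closed» as (CONV-C); NOT D1, NOT `BetaPertH`, NOT continuum, NOT Clay.  2026-08-22.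
-/

noncomputable section

open Finset
open scoped BigOperators
open Literature.MathematicalPhysics.QuantumFieldTheory
open Literature.MathematicalPhysics.QuantumFieldTheory.Balaban1983to89
open Literature.MathematicalPhysics.QuantumFieldTheory.Balaban1983to89.Beta
open B12Sec2to5 (l1 l1_nonneg)
open ExpKernelCalculus (Zl Zl_nonneg summable_exp_shift' tsum_exp_shift' l1_sub_triangle l1_sub_symm)
open Summit.QuantumFields.BalabanUV.Beta.GAN24.LatticeFreeze (l1_eq_natCast_sum_natAbs abs_sub_le_of_unit_steps)

namespace Summit.QuantumFields.BalabanUV.Beta.GAN24.LayerPushMoments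

variable {D : ℕ}

/-! ## §1 Second-order lattice Taylor: Lipschitz unit gradients ⇒ a quadratic remainder after the linear term -/

/-- [folklore] **SECOND-ORDER TAYLOR ALONG LATTICE PATHS**: if the unit gradients of `f` are Lipschitz from the base point `u` with an exponentially growing
allowance, `|(f (p+e_i) − f p) − (f (u+e_i) − f u)| ≤ σ·‖p−u‖₁·e^{κ‖p−u‖₁}` (the output shape of `LatticeFreeze.abs_sub_le_of_unit_steps` applied to each unit
gradient — i.e. what unit SECOND differences give), then
`|f v − f u − Σ_i (v−u)_i·(f (u+e_i) − f u)| ≤ σ·‖v−u‖₁²·e^{κ‖v−u‖₁}` — walk from `v` to `u` one unit at a time; each step's defect against the linear term is one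
Lipschitz allowance. -/
theorem abs_sub_sub_lin_le_of_unit_steps {f : (Fin D → ℤ) → ℝ} {u : Fin D → ℤ} {σ κ : ℝ} (hσ : 0 ≤ σ) (hκ : 0 ≤ κ)
    (h : ∀ (p : Fin D → ℤ) (i : Fin D),
      |(f (p + Pi.single i 1) - f p) - (f (u + Pi.single i 1) - f u)| ≤ σ * l1 (p - u) * Real.exp (κ * l1 (p - u)))
    (v : Fin D → ℤ) :
    |f v - f u - ∑ i, (((v - u) i : ℤ) : ℝ) * (f (u + Pi.single i 1) - f u)| ≤ σ * l1 (v - u) ^ 2 * Real.exp (κ * l1 (v - u)) := by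
  set g : Fin D → ℝ := fun i => f (u + Pi.single i 1) - f u with hg
  suffices H : ∀ (n : ℕ) (v : Fin D → ℤ), (∑ i, ((v - u) i).natAbs) = n →
      |f v - f u - ∑ i, (((v - u) i : ℤ) : ℝ) * g i| ≤ σ * (n : ℝ) ^ 2 * Real.exp (κ * n) by
    have e := l1_eq_natCast_sum_natAbs (v - u)
    have := H _ v rfl
    rw [e]; exact this
  intro n
  induction n with
  | zero =>
    intro v hv
    have hvu : v = u := by
      funext i
      have := (Finset.sum_eq_zero_iff.1 hv) i (Finset.mem_univ i)
      have : (v - u) i = 0 := Int.natAbs_eq_zero.1 this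
      simpa [sub_eq_zero] using this
    subst hvu; simp
  | succ n ih =>
    intro v hv
    obtain ⟨i, hi⟩ : ∃ i, ((v - u) i).natAbs ≠ 0 := by
      by_contra hcon
      push Not at hcon
      have : (∑ i, ((v - u) i).natAbs) = 0 := Finset.sum_eq_zero fun i _ => hcon i
      omega
    have hi' : (v - u) i ≠ 0 := fun h0 => hi (by rw [h0]; rfl)
    set s : ℤ := if 0 < (v - u) i then 1 else -1 with hs
    set v' : Fin D → ℤ := v - Pi.single i s with hv'
    have hcoord : ((v' - u) i).natAbs + 1 = ((v - u) i).natAbs := by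
      have e1 : (v' - u) i = (v - u) i - s := by simp [hv', sub_right_comm]
      rw [e1, hs]
      split_ifs with hpos <;> omega
    have hother : ∀ j, j ≠ i → (v' - u) j = (v - u) j := by
      intro j hj; simp [hv', hj]
    have hsum' : (∑ j, ((v' - u) j).natAbs) = n := by
      have h1 := Finset.add_sum_erase (Finset.univ) (fun j => ((v - u) j).natAbs) (Finset.mem_univ i)
      have h2 := Finset.add_sum_erase (Finset.univ) (fun j => ((v' - u) j).natAbs) (Finset.mem_univ i)
      have h3 : ∑ j ∈ Finset.univ.erase i, ((v' - u) j).natAbs = ∑ j ∈ Finset.univ.erase i, ((v - u) j).natAbs :=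
        Finset.sum_congr rfl fun j hj => by rw [hother j (Finset.ne_of_mem_erase hj)]
      omega
    have IH := ih v' hsum'
    have hl1v : l1 (v - u) = ((n + 1 : ℕ) : ℝ) := by rw [l1_eq_natCast_sum_natAbs, hv]
    have hl1v' : l1 (v' - u) = (n : ℝ) := by rw [l1_eq_natCast_sum_natAbs, hsum']
    -- the linear term changes by `s·g i`
    have hlin : (∑ j, (((v - u) j : ℤ) : ℝ) * g j) - (∑ j, (((v' - u) j : ℤ) : ℝ) * g j) = (s : ℝ) * g i := by
      rw [← Finset.sum_sub_distrib]
      rw [Finset.sum_eq_single i]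
      · have e1 : (v' - u) i = (v - u) i - s := by simp [hv', sub_right_comm]
        rw [e1]; push_cast; ring
      · intro j _ hj; rw [hother j hj]; ring
      · intro hi0; exact absurd (Finset.mem_univ i) hi0
    -- the one-step defect against the linear term
    have hstep : |(f v - f v') - (s : ℝ) * g i| ≤ σ * ((n + 1 : ℕ) : ℝ) * Real.exp (κ * (n + 1 : ℕ)) := by
      by_cases hpos : 0 < (v - u) i
      · have hs1 : s = 1 := by rw [hs, if_pos hpos]
        have ev : v = v' + Pi.single i 1 := by rw [hv', hs1]; abel
        have hb := h v' i
        rw [← ev, hl1v'] at hb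
        rw [hs1, Int.cast_one, one_mul]
        refine hb.trans ?_
        have e1 : Real.exp (κ * n) ≤ Real.exp (κ * (n + 1 : ℕ)) :=
          Real.exp_le_exp.2 (mul_le_mul_of_nonneg_left (by exact_mod_cast Nat.le_succ n) hκ)
        have e2 : (n : ℝ) ≤ ((n + 1 : ℕ) : ℝ) := by exact_mod_cast Nat.le_succ n
        exact mul_le_mul (mul_le_mul_of_nonneg_left e2 hσ) e1 (Real.exp_pos _).le (by positivity)
      · have hs1 : s = -1 := by rw [hs, if_neg hpos]
        have ev : v' = v + Pi.single i 1 := by rw [hv', hs1, Pi.single_neg, sub_neg_eq_add]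
        have hb := h v i
        rw [← ev, hl1v] at hb
        rw [hs1, Int.cast_neg, Int.cast_one]
        have e : (f v - f v') - (-1 : ℝ) * g i = -((f v' - f v) - g i) := by ring
        rw [e, abs_neg]
        exact hb
    calc |f v - f u - ∑ j, (((v - u) j : ℤ) : ℝ) * g j|
        = |((f v - f v') - (s : ℝ) * g i) + (f v' - f u - ∑ j, (((v' - u) j : ℤ) : ℝ) * g j)| := by
          rw [← hlin]; ring_nf
      _ ≤ |(f v - f v') - (s : ℝ) * g i| + |f v' - f u - ∑ j, (((v' - u) j : ℤ) : ℝ) * g j| := abs_add_le _ _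
      _ ≤ σ * ((n + 1 : ℕ) : ℝ) * Real.exp (κ * (n + 1 : ℕ)) + σ * (n : ℝ) ^ 2 * Real.exp (κ * n) := add_le_add hstep IH
      _ ≤ σ * ((n + 1 : ℕ) : ℝ) * Real.exp (κ * (n + 1 : ℕ)) + σ * (n : ℝ) ^ 2 * Real.exp (κ * (n + 1 : ℕ)) := by
          have : Real.exp (κ * n) ≤ Real.exp (κ * (n + 1 : ℕ)) :=
            Real.exp_le_exp.2 (mul_le_mul_of_nonneg_left (by exact_mod_cast Nat.le_succ n) hκ)
          have hn : (0 : ℝ) ≤ σ * (n : ℝ) ^ 2 := by positivity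
          nlinarith
      _ ≤ σ * (((n + 1 : ℕ) : ℝ)) ^ 2 * Real.exp (κ * (n + 1 : ℕ)) := by
          have hE : 0 ≤ Real.exp (κ * (n + 1 : ℕ)) := (Real.exp_pos _).le
          have key : ((n + 1 : ℕ) : ℝ) + (n : ℝ) ^ 2 ≤ (((n + 1 : ℕ) : ℝ)) ^ 2 := by push_cast; nlinarith
          nlinarith [mul_nonneg hσ hE]

/-! ## §2 The frozen pairing of ONE label under the moment identities (M0) and (Π): second order -/

/-- [folklore] `t²·e^{−ct} ≤ (8∕c²)·e^{−(c∕4)t}` (`LatticeFreeze.mul_exp_neg_le` twice). -/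
theorem sq_mul_exp_neg_le {c : ℝ} (hc : 0 < c) {t : ℝ} (ht : 0 ≤ t) :
    t ^ 2 * Real.exp (-c * t) ≤ 8 / c ^ 2 * Real.exp (-(c / 4) * t) := by
  have h1 := LatticeFreeze.mul_exp_neg_le hc t
  have h2 := LatticeFreeze.mul_exp_neg_le (half_pos hc) t
  have e4 : -(c / 2 / 2) * t = -(c / 4) * t := by ring
  rw [e4] at h2
  calc t ^ 2 * Real.exp (-c * t) = t * (t * Real.exp (-c * t)) := by ring
    _ ≤ t * (2 / c * Real.exp (-(c / 2) * t)) := mul_le_mul_of_nonneg_left h1 ht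
    _ = 2 / c * (t * Real.exp (-(c / 2) * t)) := by ring
    _ ≤ 2 / c * (2 / (c / 2) * Real.exp (-(c / 4) * t)) := mul_le_mul_of_nonneg_left h2 (by positivity)
    _ = 8 / c ^ 2 * Real.exp (-(c / 4) * t) := by field_simp; ring

variable {F Z : (Fin D → ℤ) → ℝ} {y : Fin D → ℤ} {σ κ δ B pF : ℝ}

/-- NOT IN PRINT; OUR BOOKKEEPING ([folklore] §1 + the two moment identities + one dominated series).  **THE FROZEN PAIRING OF ONE LABEL IS SECOND ORDER**
(the OWNER gan24-p1 g26's W11 (2): «(M0_y) `Σ_e Z(σ_j(y;e)) = 0` and (Π_y) `Σ_e (e−y)_λ Z(σ_j(y;e)) = 0` AS DISPLAYED HYPOTHESES, plus a unit SECOND-difference envelope of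
the slot leg»): for a charge profile `Z` of ONE label `y`, localised at `y` (`|Z e| ≤ B·e^{−δ‖e−y‖₁}`), with ZERO TOTAL (M0) `Σ'_e Z e = 0` and ZERO SLOT-DIPOLE (Π)
`Σ'_e (e−y)_i·Z e = 0` for every `i`, and a frozen leg product `F` whose unit gradients are Lipschitz from `y` with allowance `σ` (the shape §1 consumes — what unit
SECOND differences of `F` give) and which is itself bounded by `pF·e^{κ‖e−y‖₁}` (`0 ≤ κ < δ`),
`|Σ'_e F e·Z e| ≤ σ·B·(8∕(δ−κ)²)·Zl((δ−κ)∕4)` — NO `pF`, NO first-gradient constant: both the constant and the linear Taylor terms of `F` at `y` integrate to zero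
against `Z`. -/
theorem abs_tsum_mul_le_of_moments (hκδ : κ < δ) (hκ : 0 ≤ κ) (hσ : 0 ≤ σ) (hpF : 0 ≤ pF)
    (hF : ∀ (p : Fin D → ℤ) (i : Fin D),
      |(F (p + Pi.single i 1) - F p) - (F (y + Pi.single i 1) - F y)| ≤ σ * l1 (p - y) * Real.exp (κ * l1 (p - y)))
    (hFb : ∀ e, |F e| ≤ pF * Real.exp (κ * l1 (e - y)))
    (hZ : ∀ e, |Z e| ≤ B * Real.exp (-δ * l1 (e - y)))
    (hM0 : ∑' e, Z e = 0) (hP1 : ∀ i : Fin D, ∑' e, (((e - y) i : ℤ) : ℝ) * Z e = 0) :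
    |∑' e, F e * Z e| ≤ σ * B * (8 / (δ - κ) ^ 2 * Zl D ((δ - κ) / 4)) := by
  have hB : 0 ≤ B := by
    have h0 := hZ y
    rw [sub_self, show l1 (0 : Fin D → ℤ) = 0 by simp [l1], mul_zero, Real.exp_zero, mul_one] at h0
    exact (abs_nonneg _).trans h0
  have hδκ : 0 < δ - κ := sub_pos.2 hκδ
  have hδ : 0 < δ := hκ.trans_lt hκδ
  set g : Fin D → ℝ := fun i => F (y + Pi.single i 1) - F y with hg
  set R : (Fin D → ℤ) → ℝ := fun e => F e - F y - ∑ i, (((e - y) i : ℤ) : ℝ) * g i with hR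
  -- summability of the pieces
  have hZs : Summable Z := by
    refine Summable.of_norm_bounded ((summable_exp_shift' hδ y).mul_left B) fun e => ?_
    rw [Real.norm_eq_abs]; exact hZ e
  have hcoord : ∀ (i : Fin D) (e : Fin D → ℤ), |(((e - y) i : ℤ) : ℝ)| ≤ l1 (e - y) := fun i e => by
    have h := B12Sec2to5.abs_coord_le_l1 (e - y) i
    exact h
  have hmomS : ∀ i : Fin D, Summable fun e => (((e - y) i : ℤ) : ℝ) * Z e := by
    intro i
    refine Summable.of_norm_bounded ((summable_exp_shift' (half_pos hδ) y).mul_left (B * (2 / δ))) fun e => ?_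
    rw [Real.norm_eq_abs, abs_mul]
    have hm := LatticeFreeze.mul_exp_neg_le hδ (l1 (e - y))
    calc |(((e - y) i : ℤ) : ℝ)| * |Z e| ≤ l1 (e - y) * (B * Real.exp (-δ * l1 (e - y))) :=
          mul_le_mul (hcoord i e) (hZ e) (abs_nonneg _) (l1_nonneg _)
      _ = B * (l1 (e - y) * Real.exp (-δ * l1 (e - y))) := by ring
      _ ≤ B * (2 / δ * Real.exp (-(δ / 2) * l1 (e - y))) := mul_le_mul_of_nonneg_left hm hB
      _ = B * (2 / δ) * Real.exp (-(δ / 2) * l1 (e - y)) := by ring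
  have hFZs : Summable fun e => F e * Z e :=
    LatticeFreeze.summable_mul_of_env (u := y) hκδ hpF zero_le_one (fun e => by rw [mul_one]; exact hFb e) hZ
  -- the remainder's bound and summability
  have hRle : ∀ e, |R e| ≤ σ * l1 (e - y) ^ 2 * Real.exp (κ * l1 (e - y)) := fun e =>
    abs_sub_sub_lin_le_of_unit_steps hσ hκ hF e
  have hRZ : ∀ e, |R e * Z e| ≤ σ * B * (8 / (δ - κ) ^ 2) * Real.exp (-((δ - κ) / 4) * l1 (e - y)) := by
    intro e
    rw [abs_mul]
    have hsq := sq_mul_exp_neg_le hδκ (l1_nonneg (e - y))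
    calc |R e| * |Z e| ≤ (σ * l1 (e - y) ^ 2 * Real.exp (κ * l1 (e - y))) * (B * Real.exp (-δ * l1 (e - y))) :=
          mul_le_mul (hRle e) (hZ e) (abs_nonneg _) (by positivity)
      _ = σ * B * (l1 (e - y) ^ 2 * Real.exp (-(δ - κ) * l1 (e - y))) := by
          have : Real.exp (κ * l1 (e - y)) * Real.exp (-δ * l1 (e - y)) = Real.exp (-(δ - κ) * l1 (e - y)) := by
            rw [← Real.exp_add]; congr 1; ring
          calc (σ * l1 (e - y) ^ 2 * Real.exp (κ * l1 (e - y))) * (B * Real.exp (-δ * l1 (e - y)))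
              = σ * B * (l1 (e - y) ^ 2 * (Real.exp (κ * l1 (e - y)) * Real.exp (-δ * l1 (e - y)))) := by ring
            _ = _ := by rw [this]
      _ ≤ σ * B * (8 / (δ - κ) ^ 2 * Real.exp (-((δ - κ) / 4) * l1 (e - y))) := mul_le_mul_of_nonneg_left hsq (by positivity)
      _ = _ := by ring
  have hRZs : Summable fun e => R e * Z e :=
    Summable.of_norm_bounded ((summable_exp_shift' (by positivity : (0:ℝ) < (δ - κ) / 4) y).mul_left (σ * B * (8 / (δ - κ) ^ 2)))
      fun e => by rw [Real.norm_eq_abs]; exact hRZ e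
  -- the decomposition `F·Z = R·Z + F(y)·Z + Σ_i g_i·((e−y)_i·Z)`
  have hdec : ∀ e, F e * Z e = R e * Z e + F y * Z e + ∑ i, g i * ((((e - y) i : ℤ) : ℝ) * Z e) := by
    intro e
    have : ∑ i, g i * ((((e - y) i : ℤ) : ℝ) * Z e) = (∑ i, (((e - y) i : ℤ) : ℝ) * g i) * Z e := by
      rw [Finset.sum_mul]; exact Finset.sum_congr rfl fun i _ => by ring
    rw [this, hR]
    ring
  have hlinS : Summable fun e => ∑ i, g i * ((((e - y) i : ℤ) : ℝ) * Z e) :=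
    summable_sum fun i _ => (hmomS i).mul_left (g i)
  have htot : ∑' e, F e * Z e = ∑' e, R e * Z e := by
    rw [tsum_congr hdec]
    have s1 : ∑' e, (R e * Z e + F y * Z e + ∑ i, g i * ((((e - y) i : ℤ) : ℝ) * Z e))
        = ∑' e, (R e * Z e + F y * Z e) + ∑' e, ∑ i, g i * ((((e - y) i : ℤ) : ℝ) * Z e) :=
      ((hRZs.add (hZs.mul_left (F y))).tsum_add hlinS)
    have s2 : ∑' e, (R e * Z e + F y * Z e) = ∑' e, R e * Z e + ∑' e, F y * Z e := hRZs.tsum_add (hZs.mul_left (F y))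
    have s3 : ∑' e, F y * Z e = 0 := by rw [tsum_mul_left, hM0, mul_zero]
    have s4 : ∑' e, ∑ i, g i * ((((e - y) i : ℤ) : ℝ) * Z e) = 0 := by
      rw [Summable.tsum_finsetSum (fun i _ => (hmomS i).mul_left (g i))]
      exact Finset.sum_eq_zero fun i _ => by rw [tsum_mul_left, hP1 i, mul_zero]
    rw [s1, s2, s3, s4, add_zero, add_zero]
  rw [htot]
  have hb := tsum_of_norm_bounded (((summable_exp_shift' (by positivity : (0:ℝ) < (δ - κ) / 4) y).mul_left
    (σ * B * (8 / (δ - κ) ^ 2))).hasSum) (f := fun e => R e * Z e) (fun e => by rw [Real.norm_eq_abs]; exact hRZ e)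
  rw [Real.norm_eq_abs] at hb
  refine hb.trans (le_of_eq ?_)
  rw [tsum_mul_left, tsum_exp_shift']
  ring

/-! ## §3 Product rule: unit first and second differences of a product of two slot functions, with envelope growth from a base point -/

section Product

variable {a b : (Fin D → ℤ) → ℝ} {y : Fin D → ℤ} {κ pa ga ha pb gb hb : ℝ}

/-- [folklore] The unit SECOND difference of a product, expanded:
`∇_j∇_i(ab)(p) = (∇_j∇_i a)(p)·b(p+e_i+e_j) + ∇_i a(p)·∇_j b(p+e_i) + ∇_j a(p)·∇_i b(p+e_j) + a(p)·(∇_j∇_i b)(p)`. -/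
theorem second_diff_mul_eq (a b : (Fin D → ℤ) → ℝ) (p : Fin D → ℤ) (i j : Fin D) :
    (a (p + Pi.single i 1 + Pi.single j 1) * b (p + Pi.single i 1 + Pi.single j 1) - a (p + Pi.single j 1) * b (p + Pi.single j 1))
      - (a (p + Pi.single i 1) * b (p + Pi.single i 1) - a p * b p)
    = ((a (p + Pi.single i 1 + Pi.single j 1) - a (p + Pi.single j 1)) - (a (p + Pi.single i 1) - a p)) * b (p + Pi.single i 1 + Pi.single j 1)
      + (a (p + Pi.single i 1) - a p) * (b (p + Pi.single i 1 + Pi.single j 1) - b (p + Pi.single i 1))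
      + (a (p + Pi.single j 1) - a p) * (b (p + Pi.single i 1 + Pi.single j 1) - b (p + Pi.single j 1))
      + a p * ((b (p + Pi.single i 1 + Pi.single j 1) - b (p + Pi.single j 1)) - (b (p + Pi.single i 1) - b p)) := by
  ring

/-- [folklore] **THE UNIT SECOND DIFFERENCES OF A PRODUCT** from the factors' sup ∕ unit-gradient ∕ unit-second-difference allowances with envelope growth
`E(p) = e^{κ‖p−y‖₁}` from the base point `y` (`κ ≥ 0`): `|∇_j∇_i(ab)(p)| ≤ (ha·pb + 2·ga·gb + pa·hb)·e^{2κ}·e^{2κ‖p−y‖₁}` — every term carries either ONE second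
difference or TWO first differences (the homogeneity the (LT-3) ledger needs: `L^{−(d+4)}·L^{−(d+2)}` or `L^{−(d+3)}·L^{−(d+3)}`). -/
theorem abs_second_diff_mul_le (hκ : 0 ≤ κ) (hpa : 0 ≤ pa) (hga : 0 ≤ ga) (hha : 0 ≤ ha) (hpb : 0 ≤ pb) (hgb : 0 ≤ gb) (hhb : 0 ≤ hb)
    (ha0 : ∀ p, |a p| ≤ pa * Real.exp (κ * l1 (p - y)))
    (ha1 : ∀ p i, |a (p + Pi.single i 1) - a p| ≤ ga * Real.exp (κ * l1 (p - y)))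
    (ha2 : ∀ p i j, |(a (p + Pi.single i 1 + Pi.single j 1) - a (p + Pi.single j 1)) - (a (p + Pi.single i 1) - a p)|
      ≤ ha * Real.exp (κ * l1 (p - y)))
    (hb0 : ∀ p, |b p| ≤ pb * Real.exp (κ * l1 (p - y)))
    (hb1 : ∀ p i, |b (p + Pi.single i 1) - b p| ≤ gb * Real.exp (κ * l1 (p - y)))
    (hb2 : ∀ p i j, |(b (p + Pi.single i 1 + Pi.single j 1) - b (p + Pi.single j 1)) - (b (p + Pi.single i 1) - b p)|
      ≤ hb * Real.exp (κ * l1 (p - y)))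
    (p : Fin D → ℤ) (i j : Fin D) :
    |(a (p + Pi.single i 1 + Pi.single j 1) * b (p + Pi.single i 1 + Pi.single j 1) - a (p + Pi.single j 1) * b (p + Pi.single j 1))
      - (a (p + Pi.single i 1) * b (p + Pi.single i 1) - a p * b p)|
      ≤ (ha * pb + 2 * ga * gb + pa * hb) * Real.exp (2 * κ) * Real.exp (2 * κ * l1 (p - y)) := by
  -- envelope growth at the shifted points
  have hstep : ∀ (q : Fin D → ℤ) (k : Fin D), l1 (q + Pi.single k 1 - y) ≤ l1 (q - y) + 1 := by
    intro q k
    have t := l1_sub_triangle (q + Pi.single k 1) q y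
    have e1 : l1 (q + Pi.single k 1 - q) = 1 := by
      rw [add_sub_cancel_left]
      unfold l1
      rw [Finset.sum_eq_single k]
      · simp
      · intro b _ hb; simp [hb]
      · intro h; exact absurd (Finset.mem_univ k) h
    linarith
  set E : ℝ := Real.exp (κ * l1 (p - y)) with hE
  have hE0 : 0 ≤ E := (Real.exp_pos _).le
  have hE1 : ∀ k, Real.exp (κ * l1 (p + Pi.single k 1 - y)) ≤ Real.exp κ * E := by
    intro k
    rw [hE, ← Real.exp_add]
    exact Real.exp_le_exp.2 (by nlinarith [hstep p k])
  have hE2 : Real.exp (κ * l1 (p + Pi.single i 1 + Pi.single j 1 - y)) ≤ Real.exp (2 * κ) * E := by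
    rw [hE, ← Real.exp_add]
    have h1 := hstep (p + Pi.single i 1) j
    have h2 := hstep p i
    exact Real.exp_le_exp.2 (by nlinarith)
  have hk1 : Real.exp κ ≤ Real.exp (2 * κ) := Real.exp_le_exp.2 (by linarith)
  have hk0 : 1 ≤ Real.exp (2 * κ) := Real.one_le_exp_iff.2 (by positivity) |> fun h => by
    have := Real.exp_le_exp.2 (show (0:ℝ) ≤ 2 * κ by positivity); rwa [Real.exp_zero] at this
  rw [second_diff_mul_eq]
  have t1 : |((a (p + Pi.single i 1 + Pi.single j 1) - a (p + Pi.single j 1)) - (a (p + Pi.single i 1) - a p))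
      * b (p + Pi.single i 1 + Pi.single j 1)| ≤ (ha * E) * (pb * (Real.exp (2 * κ) * E)) := by
    rw [abs_mul]
    exact mul_le_mul (ha2 p i j) ((hb0 _).trans (mul_le_mul_of_nonneg_left hE2 hpb)) (abs_nonneg _) (by positivity)
  have t2 : |(a (p + Pi.single i 1) - a p) * (b (p + Pi.single i 1 + Pi.single j 1) - b (p + Pi.single i 1))|
      ≤ (ga * E) * (gb * (Real.exp κ * E)) := by
    rw [abs_mul]
    exact mul_le_mul (ha1 p i) ((hb1 _ j).trans (mul_le_mul_of_nonneg_left (hE1 i) hgb)) (abs_nonneg _) (by positivity)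
  have t3 : |(a (p + Pi.single j 1) - a p) * (b (p + Pi.single i 1 + Pi.single j 1) - b (p + Pi.single j 1))|
      ≤ (ga * E) * (gb * (Real.exp κ * E)) := by
    rw [abs_mul]
    have e : p + Pi.single i 1 + Pi.single j 1 = p + Pi.single j 1 + Pi.single i 1 := by abel
    rw [e]
    exact mul_le_mul (ha1 p j) ((hb1 _ i).trans (mul_le_mul_of_nonneg_left (hE1 j) hgb)) (abs_nonneg _) (by positivity)
  have t4 : |a p * ((b (p + Pi.single i 1 + Pi.single j 1) - b (p + Pi.single j 1)) - (b (p + Pi.single i 1) - b p))|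
      ≤ (pa * E) * (hb * E) := by
    rw [abs_mul]
    exact mul_le_mul (ha0 p) (hb2 p i j) (abs_nonneg _) (by positivity)
  have hEE : E * E = Real.exp (2 * κ * l1 (p - y)) := by rw [hE, ← Real.exp_add]; congr 1; ring
  calc _ ≤ (ha * E) * (pb * (Real.exp (2 * κ) * E)) + (ga * E) * (gb * (Real.exp κ * E)) + (ga * E) * (gb * (Real.exp κ * E))
        + (pa * E) * (hb * E) := by
        refine (abs_add_le _ _).trans (add_le_add ((abs_add_le _ _).trans (add_le_add ((abs_add_le _ _).trans (add_le_add t1 t2)) t3)) t4)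
    _ = (ha * pb * Real.exp (2 * κ) + 2 * ga * gb * Real.exp κ + pa * hb * 1) * (E * E) := by ring
    _ ≤ (ha * pb * Real.exp (2 * κ) + 2 * ga * gb * Real.exp (2 * κ) + pa * hb * Real.exp (2 * κ)) * (E * E) := by
        have hEE0 : 0 ≤ E * E := by positivity
        refine mul_le_mul_of_nonneg_right ?_ hEE0
        have h2 : 2 * ga * gb * Real.exp κ ≤ 2 * ga * gb * Real.exp (2 * κ) := mul_le_mul_of_nonneg_left hk1 (by positivity)
        have h3 : pa * hb * 1 ≤ pa * hb * Real.exp (2 * κ) := mul_le_mul_of_nonneg_left hk0 (by positivity)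
        linarith
    _ = (ha * pb + 2 * ga * gb + pa * hb) * Real.exp (2 * κ) * Real.exp (2 * κ * l1 (p - y)) := by rw [hEE]; ring

/-- [folklore] **THE UNIT GRADIENT OF A PRODUCT**: `|∇_i(ab)(p)| ≤ (ga·pb + pa·gb)·e^{κ}·e^{2κ‖p−y‖₁}`. -/
theorem abs_diff_mul_le (hκ : 0 ≤ κ) (hpa : 0 ≤ pa) (hgb : 0 ≤ gb) (hpb : 0 ≤ pb)
    (ha0 : ∀ p, |a p| ≤ pa * Real.exp (κ * l1 (p - y)))
    (ha1 : ∀ p i, |a (p + Pi.single i 1) - a p| ≤ ga * Real.exp (κ * l1 (p - y)))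
    (hb0 : ∀ p, |b p| ≤ pb * Real.exp (κ * l1 (p - y)))
    (hb1 : ∀ p i, |b (p + Pi.single i 1) - b p| ≤ gb * Real.exp (κ * l1 (p - y)))
    (p : Fin D → ℤ) (i : Fin D) :
    |a (p + Pi.single i 1) * b (p + Pi.single i 1) - a p * b p| ≤ (ga * pb + pa * gb) * Real.exp κ * Real.exp (2 * κ * l1 (p - y)) := by
  have hstep : l1 (p + Pi.single i 1 - y) ≤ l1 (p - y) + 1 := by
    have t := l1_sub_triangle (p + Pi.single i 1) p y
    have e1 : l1 (p + Pi.single i 1 - p) = 1 := by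
      rw [add_sub_cancel_left]
      unfold l1
      rw [Finset.sum_eq_single i]
      · simp
      · intro b _ hb; simp [hb]
      · intro h; exact absurd (Finset.mem_univ i) h
    linarith
  set E : ℝ := Real.exp (κ * l1 (p - y)) with hE
  have hE1 : Real.exp (κ * l1 (p + Pi.single i 1 - y)) ≤ Real.exp κ * E := by
    rw [hE, ← Real.exp_add]; exact Real.exp_le_exp.2 (by nlinarith)
  have hk0 : 1 ≤ Real.exp κ := by have := Real.exp_le_exp.2 hκ; rwa [Real.exp_zero] at this
  have e : a (p + Pi.single i 1) * b (p + Pi.single i 1) - a p * b p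
      = (a (p + Pi.single i 1) - a p) * b (p + Pi.single i 1) + a p * (b (p + Pi.single i 1) - b p) := by ring
  rw [e]
  have t1 : |(a (p + Pi.single i 1) - a p) * b (p + Pi.single i 1)| ≤ (ga * E) * (pb * (Real.exp κ * E)) := by
    rw [abs_mul]
    have hga : 0 ≤ ga := by
      have := (abs_nonneg _).trans (ha1 p i); exact (mul_nonneg_iff_of_pos_right (Real.exp_pos _)).mp this
    exact mul_le_mul (ha1 p i) ((hb0 _).trans (mul_le_mul_of_nonneg_left hE1 hpb)) (abs_nonneg _) (by positivity)
  have t2 : |a p * (b (p + Pi.single i 1) - b p)| ≤ (pa * E) * (gb * E) := by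
    rw [abs_mul]; exact mul_le_mul (ha0 p) (hb1 p i) (abs_nonneg _) (by positivity)
  have hEE : E * E = Real.exp (2 * κ * l1 (p - y)) := by rw [hE, ← Real.exp_add]; congr 1; ring
  calc _ ≤ (ga * E) * (pb * (Real.exp κ * E)) + (pa * E) * (gb * E) := (abs_add_le _ _).trans (add_le_add t1 t2)
    _ = (ga * pb * Real.exp κ + pa * gb * 1) * (E * E) := by ring
    _ ≤ (ga * pb * Real.exp κ + pa * gb * Real.exp κ) * (E * E) := by
        refine mul_le_mul_of_nonneg_right ?_ (by positivity)
        have : pa * gb * 1 ≤ pa * gb * Real.exp κ := mul_le_mul_of_nonneg_left hk0 (by positivity)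
        have hga : 0 ≤ ga * pb * Real.exp κ := by
          have hga' : 0 ≤ ga := by
            have := (abs_nonneg _).trans (ha1 p i); exact (mul_nonneg_iff_of_pos_right (Real.exp_pos _)).mp this
          positivity
        linarith
    _ = (ga * pb + pa * gb) * Real.exp κ * Real.exp (2 * κ * l1 (p - y)) := by rw [hEE]; ring

end Product

end Summit.QuantumFields.BalabanUV.Beta.GAN24.LayerPushMoments

end
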